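import Mathlib.Algebra.Polynomial.Degree.SmallDegree
import Mathlib.AlgebraicGeometry.EllipticCurve.Affine.Point
import Literature.NumberTheory.DiophantineGeometry.LocalReductionProofs
import Literature.NumberTheory.DiophantineGeometry.LocalReductionHasMultiplicativeReductionAtProofs
import Literature.NumberTheory.DiophantineGeometry.LocalReductionIsIntegralAtProofs
import Literature.RingTheory.DiscreteValuationRing.AdicCompletionResidueField
import HarnessLib

/-!
# D-0123(C) IUT REPAIR-CATALOGUE (rung LADDER-ABC:A2), row RC-441 (Zhou 2025 «2-torsion initial Θ-data»,
# [IUTchI] Def. 3.1 (b) datum-class variant) — a CLASSICAL WITNESS for one print-silent check-list item: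
# rational 2-torsion (with `√−1` in the completion) does NOT force SPLIT multiplicative reduction

Record file (D-0012) of the abc-iut cell, seat abc-iut-rcat-tst-7 (KEY RC441); PROOF-ONLY (no definition, no
instance, no notation, no named fact). TAKES NO SIDE on [IUTchIII] Cor. 3.12 / [IUTchIV] Thm. 1.10, on any author or
on the variant (D-0045); nothing here asserts abc proved or refuted. The variant is a claim-tagged READING of the
literature; this file is classical arithmetic of ONE explicit curve over `ℚ`.

CONTEXT (catalogue sheet HOME/staging/RCAT/tst-7/RC-441.md). The tree's typing of [IUTchI] Def. 3.1
(abc-iut-L5-t2 `Literature.IUT.HodgeTheaters.InitialThetaData`) uses the 3-part of clause (b) «the 2·3-torsion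
points of `E_F` are rational over `F`» at one PRINT-SILENT site: abc-iut-L5-t12's
`InitialThetaDataSplitBaseProofs.hasSplitMultiplicativeReductionAt_base_of_mem_VFbad` — the BASE curve `E_F` has
SPLIT multiplicative reduction at every `v ∈ V(F)^bad` (hence a literal Tate parameter `q_v ∈ F_v`), by the generic
lemma «multiplicative reduction + more than `n` rational points killed by an ODD `n` ⟹ split». Zhou's variant
(arXiv:2510.05448 §2.1 Def. 2.1) keeps `√−1 ∈ F` (Def. 3.1 (a)) and replaces the 2·3-torsion clause by «2-torsion
rational + `E_F` has a model over `F_mod`». THIS FILE records that the odd-`n` lemma has no even analogue in the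
relevant situation: the curve `y² = x(x − 2)(x − 25) = x³ − 27x² + 50x` over `ℚ` has its three points of order 2
rational, and at `p = 5` — where `−1` is a square (`2² ≡ −1`), so `√−1 ∈ ℚ₅` and the local picture is that of a place
of `ℚ(√−1)` above `5` — its (minimal) equation has MULTIPLICATIVE reduction (`5 ∤ c₄ = 9264`,
`Δ = 21160000 = 2⁶·5⁴·23²`) which is NOT split: the node-tangent quadratic `c₄T² + a₁c₄T − (54b₆ − 3b₂b₄ + a₂c₄)
= 9264·T² + 217728` has no root mod `5` (`4T² + 3 ≡ 0` forces `T² ≡ 3`, a non-square). So under the variant's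
clauses the base-curve split-ness of L5-t12 is NOT available in general; what print uses at `v ∈ V^bad`
(`E_K = E_F ×_F K` split over `K_v` from `E_F[l] ⊆ E_F(K)`, `l` odd — L5-t12 `InitialThetaDataSplitProofs`;
`ord_v(q_v) := ord_v(Δ_min)`) is untouched. Whether the variant ever needs base-curve split-ness is for its author,
not this cell (located/computed ≠ adjudicated). Pattern of proof: the tree's `Curve5077aRootNumber`
(non-split multiplicative reduction of 5077a at 5077), with the Jacobi-symbol step replaced by `decide` over `ZMod 5`.
Standard axioms only.
-/

open IsDedekindDomain IsDedekindDomain.HeightOneSpectrum WeierstrassCurve Polynomial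

namespace Summit.ABC.IUTFork.Repair.RcatZhou2TorsionNonsplitWitness

/-! ## 1. The curve `y² = x³ − 27x² + 50x = x(x − 2)(x − 25)` over `ℚ`: invariants -/

/-- `b₂ = −108`. [folklore] -/
theorem W_b₂ : (⟨0, -27, 0, 50, 0⟩ : WeierstrassCurve ℚ).b₂ = -108 := by norm_num [WeierstrassCurve.b₂]

/-- `b₄ = 100`. [folklore] -/
theorem W_b₄ : (⟨0, -27, 0, 50, 0⟩ : WeierstrassCurve ℚ).b₄ = 100 := by norm_num [WeierstrassCurve.b₄]

/-- `b₆ = 0`. [folklore] -/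
theorem W_b₆ : (⟨0, -27, 0, 50, 0⟩ : WeierstrassCurve ℚ).b₆ = 0 := by norm_num [WeierstrassCurve.b₆]

/-- `c₄ = 9264 = 2⁴·3·193` (prime to `5`). [folklore] -/
theorem W_c₄ : (⟨0, -27, 0, 50, 0⟩ : WeierstrassCurve ℚ).c₄ = 9264 := by
  norm_num [WeierstrassCurve.c₄, WeierstrassCurve.b₂, WeierstrassCurve.b₄]

/-- `Δ = 21160000 = 2⁶·5⁴·23²`. [folklore] -/
theorem W_Δ : (⟨0, -27, 0, 50, 0⟩ : WeierstrassCurve ℚ).Δ = 21160000 := by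
  norm_num [WeierstrassCurve.Δ, WeierstrassCurve.b₂, WeierstrassCurve.b₄, WeierstrassCurve.b₆,
    WeierstrassCurve.b₈]

/-- The curve is an elliptic curve (`Δ ≠ 0`). [folklore] -/
theorem W_isElliptic : (⟨0, -27, 0, 50, 0⟩ : WeierstrassCurve ℚ).IsElliptic := by
  rw [WeierstrassCurve.isElliptic_iff, W_Δ]; norm_num

/-! ## 2. Full rational `2`-torsion: the three points `(0,0)`, `(2,0)`, `(25,0)` of order `2` -/

/-- `(0, 0)`, `(2, 0)` and `(25, 0)` are nonsingular `ℚ`-points of `y² = x(x − 2)(x − 25)`. [folklore] -/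
theorem W_nonsingular_two_torsion :
    (⟨0, -27, 0, 50, 0⟩ : WeierstrassCurve ℚ).toAffine.Nonsingular 0 0 ∧
      (⟨0, -27, 0, 50, 0⟩ : WeierstrassCurve ℚ).toAffine.Nonsingular 2 0 ∧
      (⟨0, -27, 0, 50, 0⟩ : WeierstrassCurve ℚ).toAffine.Nonsingular 25 0 := by
  refine ⟨?_, ?_, ?_⟩ <;>
  · rw [WeierstrassCurve.Affine.nonsingular_iff, WeierstrassCurve.Affine.equation_iff]
    norm_num

/-- **Full rational `2`-torsion**: every rational point `(r, 0)` of the curve — in particular the three points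
`r ∈ {0, 2, 25}` of `W_nonsingular_two_torsion` — has order `2` (`P + P = O`: a point with `y = −y − a₁x − a₃`, here
`y = 0`, is its own negative). With `O` these are all four `2`-torsion points of the curve over `ℚ̄` (`#E[2] = 4`), so
«the 2-torsion points are rational over `ℚ`» in the sense of the variant's clause. [folklore] -/
theorem W_two_torsion_rational (r : ℚ)
    (h : (⟨0, -27, 0, 50, 0⟩ : WeierstrassCurve ℚ).toAffine.Nonsingular r 0) :
    (WeierstrassCurve.Affine.Point.some r 0 h : (⟨0, -27, 0, 50, 0⟩ : WeierstrassCurve ℚ).toAffine.Point) +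
      WeierstrassCurve.Affine.Point.some r 0 h = 0 := by
  have hy : (0 : ℚ) = (⟨0, -27, 0, 50, 0⟩ : WeierstrassCurve ℚ).toAffine.negY r 0 := by
    simp [WeierstrassCurve.Affine.negY]
  rw [WeierstrassCurve.Affine.Point.add_of_Y_eq rfl hy]

/-- `−1` is a square modulo `5` (`2² = 4 = −1`): `√−1 ∈ ℚ₅` by Hensel, so the completion of `ℚ(√−1)` at a place
above `5` is `ℚ₅` and the reduction type of a curve over `ℚ` at `5` is its reduction type there. (Only the residue-field
fact is recorded here.) [folklore] -/
theorem neg_one_isSquare_zmod_five : IsSquare (-1 : ZMod 5) := ⟨2, by decide⟩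

/-! ## 3. At `p = 5`: multiplicative, NOT split -/

/-- The equation has integer coefficients: integral at every finite place of `ℤ`. [folklore] -/
theorem W_isIntegralAt (v : HeightOneSpectrum ℤ) : (⟨0, -27, 0, 50, 0⟩ : WeierstrassCurve ℚ).IsIntegralAt v := by
  rw [isIntegralAt_iff_valuation_le_one]
  refine ⟨?_, ?_, ?_, ?_, ?_⟩
  · simp
  · have h := v.valuation_le_one (K := ℚ) (-27 : ℤ)
    change v.valuation ℚ ((algebraMap ℤ ℚ) (-27 : ℤ)) ≤ 1 at h
    have e : (algebraMap ℤ ℚ) (-27 : ℤ) = (-27 : ℚ) := by rw [map_neg, map_ofNat]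
    rw [e] at h
    simpa using h
  · simp
  · have h := v.valuation_le_one (K := ℚ) (50 : ℤ)
    change v.valuation ℚ ((algebraMap ℤ ℚ) (50 : ℤ)) ≤ 1 at h
    have e : (algebraMap ℤ ℚ) (50 : ℤ) = (50 : ℚ) := by rw [map_ofNat]
    rw [e] at h
    simpa using h
  · simp

/-- `9264 ∉ v` when `5 ∈ v` (Bezout: `4·9264 − 7411·5 = 1`). [folklore] -/
private theorem not_mem_9264 {v : HeightOneSpectrum ℤ} (h5 : (5 : ℤ) ∈ v.asIdeal) :
    (9264 : ℤ) ∉ v.asIdeal := by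
  intro h9264
  have hone : (1 : ℤ) ∈ v.asIdeal := by
    have := v.asIdeal.add_mem (v.asIdeal.mul_mem_left (-7411) h5) (v.asIdeal.mul_mem_left 4 h9264)
    convert this using 1
    norm_num
  exact v.isPrime.ne_top ((Ideal.eq_top_iff_one _).mpr hone)

/-- At the place above `5`, `c₄ = 9264` is a `v`-unit. [folklore] -/
theorem valuation_c₄_eq_one {v : HeightOneSpectrum ℤ} (h5 : (5 : ℤ) ∈ v.asIdeal) :
    v.valuation ℚ (⟨0, -27, 0, 50, 0⟩ : WeierstrassCurve ℚ).c₄ = 1 := by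
  rw [W_c₄]
  by_contra h
  have h' : v.valuation ℚ (algebraMap ℤ ℚ 9264) ≠ 1 := by simpa using h
  have hlt := lt_of_le_of_ne (v.valuation_le_one (9264 : ℤ)) h'
  exact not_mem_9264 h5 ((v.valuation_lt_one_iff_mem (9264 : ℤ)).mp hlt)

/-- At the place above `5`, `v(Δ) < 1` (`Δ = 5 · 4232000`). [folklore] -/
theorem valuation_Δ_lt_one {v : HeightOneSpectrum ℤ} (h5 : (5 : ℤ) ∈ v.asIdeal) :
    v.valuation ℚ (⟨0, -27, 0, 50, 0⟩ : WeierstrassCurve ℚ).Δ < 1 := by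
  rw [W_Δ]
  have e : (21160000 : ℚ) = algebraMap ℤ ℚ 5 * algebraMap ℤ ℚ 4232000 := by
    rw [map_ofNat, map_ofNat]; norm_num
  rw [e, map_mul]
  calc v.valuation ℚ (algebraMap ℤ ℚ 5) * v.valuation ℚ (algebraMap ℤ ℚ 4232000)
      ≤ v.valuation ℚ (algebraMap ℤ ℚ 5) * 1 :=
        mul_le_mul_right (v.valuation_le_one (4232000 : ℤ)) _
    _ < 1 := by rw [mul_one]; exact (v.valuation_lt_one_iff_mem (5 : ℤ)).mpr h5

/-- **Multiplicative reduction at `5`** (`v(c₄) = 1`, `v(Δ) < 1`; Silverman AEC VII.5 Prop. 5.1 (b)).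
[cite: SilvermanAEC2009, VII.5 Prop. 5.1(b)] -/
theorem hasMultiplicativeReductionAt_five {v : HeightOneSpectrum ℤ} (h5 : (5 : ℤ) ∈ v.asIdeal) :
    (⟨0, -27, 0, 50, 0⟩ : WeierstrassCurve ℚ).HasMultiplicativeReductionAt v :=
  haveI := W_isElliptic
  hasMultiplicativeReductionAt_of_valuation_c₄_eq_one (W_isIntegralAt v) (valuation_c₄_eq_one h5)
    (valuation_Δ_lt_one h5)

/-- The arithmetic heart: `4T² + 3` has no root in `𝔽₅` (`T² = 3` is not a square mod `5`), written for the integer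
lift `9264 r² + 217728 ∈ v ∋ 5`. [folklore] -/
private theorem no_int_root {v : HeightOneSpectrum ℤ} (h5 : (5 : ℤ) ∈ v.asIdeal) (r : ℤ)
    (hr : 9264 * r ^ 2 + 217728 ∈ v.asIdeal) : False := by
  have hdvd : (5 : ℤ) ∣ 9264 * r ^ 2 + 217728 := by
    by_contra hnd
    have hp : Prime (5 : ℤ) := Int.prime_iff_natAbs_prime.mpr Nat.prime_five
    obtain ⟨a, b, hab⟩ := (hp.coprime_iff_not_dvd).mpr hnd
    have hone : (1 : ℤ) ∈ v.asIdeal := by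
      rw [← hab]
      exact v.asIdeal.add_mem (v.asIdeal.mul_mem_left a h5) (v.asIdeal.mul_mem_left b hr)
    exact v.isPrime.ne_top ((Ideal.eq_top_iff_one _).mpr hone)
  have hz : ((9264 * r ^ 2 + 217728 : ℤ) : ZMod 5) = 0 :=
    (ZMod.intCast_zmod_eq_zero_iff_dvd _ 5).mpr (by exact_mod_cast hdvd)
  push_cast at hz
  have key : ∀ z : ZMod 5, (9264 : ZMod 5) * z ^ 2 + 217728 ≠ 0 := by decide
  exact key _ hz

/-- **NON-split multiplicative reduction at `5`**: for the place `v` above `5`, the chosen local minimal model does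
NOT have split multiplicative reduction — the node-tangent quadratic `9264·T² + 217728` of the (minimal, integral)
equation has no root in `κ(O_v) = 𝔽₅`; the tangent slopes at the node `(0,0)` of `y² ≡ x²(x − 2)` satisfy
`T² ≡ −2 ≡ 3 (mod 5)`. [cite: SilvermanAEC2009, VII.5 Prop. 5.1(b)] -/
theorem not_hasSplitMultiplicativeReductionAt_five {v : HeightOneSpectrum ℤ} (h5 : (5 : ℤ) ∈ v.asIdeal) :
    ¬ (⟨0, -27, 0, 50, 0⟩ : WeierstrassCurve ℚ).HasSplitMultiplicativeReductionAt v := by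
  set E : WeierstrassCurve ℚ := ⟨0, -27, 0, 50, 0⟩ with hE
  haveI : E.IsElliptic := W_isElliptic
  have hc₄ := valuation_c₄_eq_one h5
  have hW := W_isIntegralAt v
  set O := v.adicCompletionIntegers ℚ with hO
  set K := v.adicCompletion ℚ with hK
  set EK := E.baseChange K with hEK
  haveI hmin : EK.IsMinimal O :=
    isMinimalAt_of_lt_valuation_c₄ hW
      (by rw [hc₄, ← WithZero.exp_zero]; exact WithZero.exp_lt_exp.mpr (by norm_num))
  haveI : EK.IsElliptic := by rw [hEK, WeierstrassCurve.baseChange]; infer_instance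
  obtain ⟨D, hD⟩ : ∃ D : VariableChange K, E.localMinimalModel v = D • EK := ⟨_, rfl⟩
  unfold WeierstrassCurve.HasSplitMultiplicativeReductionAt
  rw [hasSplitMultiplicativeReduction_iff_of_isMinimal_of_eq_smul O hD EK.isUnit_Δ.ne_zero,
    hasSplitMultiplicativeReduction_iff]
  intro hS
  obtain ⟨hm, hsplit⟩ := hS
  -- the integral model of `EK = E ⊗ K_v` has the integer coefficients of `E`
  have inj := IsFractionRing.injective O K
  have hnat : ∀ n : ℕ, algebraMap O K (n : O) = (n : K) := fun n => map_natCast _ n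
  have hc4 : (EK.integralModel O).c₄ = ((9264 : ℕ) : O) := inj <| by
    rw [integralModel_c₄_eq, hnat, hEK, WeierstrassCurve.baseChange, map_c₄, W_c₄]; norm_num
  have ha1 : (EK.integralModel O).a₁ = 0 := inj <| by
    rw [integralModel_a₁_eq, hEK, WeierstrassCurve.baseChange, map_a₁]; simp [hE]
  have ha2 : (EK.integralModel O).a₂ = -((27 : ℕ) : O) := inj <| by
    rw [integralModel_a₂_eq, map_neg, hnat, hEK, WeierstrassCurve.baseChange, map_a₂]; simp [hE]
  have hb2 : (EK.integralModel O).b₂ = -((108 : ℕ) : O) := inj <| by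
    rw [integralModel_b₂_eq, map_neg, hnat, hEK, WeierstrassCurve.baseChange, map_b₂, W_b₂]; norm_num
  have hb4 : (EK.integralModel O).b₄ = ((100 : ℕ) : O) := inj <| by
    rw [integralModel_b₄_eq, hnat, hEK, WeierstrassCurve.baseChange, map_b₄, W_b₄]; norm_num
  have hb6 : (EK.integralModel O).b₆ = 0 := inj <| by
    rw [integralModel_b₆_eq, hEK, WeierstrassCurve.baseChange, map_b₆, W_b₆]; simp
  rw [hc4, ha1, ha2, hb2, hb4, hb6] at hsplit
  push_cast at hsplit
  -- the node-tangent quadratic over `κ(O_v)` is `9264 T² + 217728`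
  set φ : O →+* IsLocalRing.ResidueField O := algebraMap O (IsLocalRing.ResidueField O) with hφ
  have h9264 : (9264 : IsLocalRing.ResidueField O) ≠ 0 := by
    intro h0
    have : ((IsLocalRing.residue O).comp (algebraMap ℤ O)) 9264 = 0 := by
      rw [RingHom.comp_apply, map_ofNat, map_ofNat]; exact h0
    have hmem : (9264 : ℤ) ∈ v.asIdeal := by
      rw [← ker_residue_comp_algebraMap ℚ v]; exact this
    exact not_mem_9264 h5 hmem
  have hpoly : Polynomial.map φ (C (9264 : O) * X ^ 2 + C (0 * 9264) * X
      - C (54 * 0 - 3 * (-108) * 100 + (-27) * 9264)) = C (9264 : IsLocalRing.ResidueField O) * X ^ 2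
      + C (0 : IsLocalRing.ResidueField O) * X + C (217728 : IsLocalRing.ResidueField O) := by
    simp only [Polynomial.map_sub, Polynomial.map_add, Polynomial.map_mul, Polynomial.map_pow,
      Polynomial.map_X, map_mul, map_sub, map_add, map_neg, map_ofNat, map_zero]
    norm_num [sub_eq_add_neg, ← C_neg]
  rw [hpoly] at hsplit
  have hdeg : (C (9264 : IsLocalRing.ResidueField O) * X ^ 2 + C (0 : IsLocalRing.ResidueField O) * X
      + C (217728 : IsLocalRing.ResidueField O)).degree ≠ 0 := by
    rw [degree_quadratic h9264]; decide
  obtain ⟨t, ht⟩ := hsplit.exists_eval_eq_zero hdeg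
  simp only [eval_add, eval_mul, eval_C, eval_pow, eval_X, zero_mul, add_zero] at ht
  -- lift the root to an integer
  obtain ⟨r, hr⟩ := residue_comp_algebraMap_surjective ℚ v t
  have hι : ((IsLocalRing.residue O).comp (algebraMap ℤ O)) (9264 * r ^ 2 + 217728) = 0 := by
    rw [map_add, map_mul, map_pow, hr, map_ofNat, map_ofNat]
    linear_combination ht
  have hmem : (9264 * r ^ 2 + 217728 : ℤ) ∈ v.asIdeal := by
    rw [← ker_residue_comp_algebraMap ℚ v]; exact hι
  exact no_int_root h5 r hmem

end Summit.ABC.IUTFork.Repair.RcatZhou2TorsionNonsplitWitness
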